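import Literature.Analysis.FluidPDE.UniformDriftBackwardNonuniqueness
import Literature.Analysis.FluidPDE.ParasiticSlabFlow
import Literature.Analysis.FluidPDE.KinematicApexWitness
import HarnessLib

/-!
# Two more same-scar pairs on the whole slab: a SINGULAR rate-Type-I Navier–Stokes pair without spatial
# decay, and a singular apex-class pair without the equations

Analysis/FluidPDE proofs-layer file (theorems + data definitions in the sub-namespace `ScarWitness`, no new
`Prop` facts) over the accepted `IsSuitableWeakSolutionOn`, `HasWeakSpatialGradientOn` (`SuitableWeak.lean`),
`HasTypeIDecay` / `HasTypeITimeDecay` (`SelfSimilar.lean`; KNSS 2009 (1.4)/(1.6)), Albritton–Barker's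
`typeIBound` = `𝐈`, `IsBackwardSingularPoint` (`LocalTypeI.lean`), the parasitic flow `parasiticVelocity C`
(`ParasiticSlabFlow.lean`) and the kinematic bump `ParabolicBump.apexVelocity` (`KinematicApexWitness.lean`).
Companion of `UniformDriftBackwardNonuniqueness.lean` (Lei–Yang–Yuan 2024, Example 1.2: `0` vs `t e`, both
REGULAR, no decay).  Here the two remaining corners of the hypothesis cube of route item `ScarRigidity`
(stmt-NavierStokesRegularity-11717, route RellichScar; "two singular apex Type-I profiles with the same
final-time trace off the origin coincide") are inhabited by NON-coinciding pairs:

* `exists_sameScar_rate_singular_not_aeEq_slab` — **two classical (hence suitable weak) Navier–Stokes flows on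
  `(−∞,0) × ℝ³`, BOTH backward-singular at the origin, BOTH with the Type-I RATE `‖u‖ ≤ C/√(−t)`, with the
  same scar, not a.e. equal**: the parasitic drifts `b₁(t) = (1/√−t) e₀` and `b₂ = b₁ + ((−t)/(1+t²)) e₀`,
  `pᵢ = −bᵢ′(t)·x` (KNSS 2009 §1).  So it is the SPATIAL part of the Type-I hypotheses (`𝐈 < ∞`, the `‖x‖`
  in `C/(‖x‖+√−t)`) that excludes Galilean ambiguity — neither the rate nor the singularity does;
* `exists_sameScar_apex_singular_kinematic_not_aeEq_slab` — **two fields with weak spatial gradients,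
  `𝐈(ℝ³×ℝ₋) < ∞`, the apex bound `‖u‖ ≤ 3/(‖x‖+√−t)`, BOTH backward-singular at the origin, the same (zero)
  scar, not a.e. equal**: the bump `χ(|x|²/(−t))/√(−t) e₀` and its negative.  So the Navier–Stokes equations are
  load-bearing even inside the full Albritton–Barker function class;
* tools: `ScarWitness.ampDrift_isSuitable` (EVERY smooth amplitude `a(t)` gives a suitable weak solution
  `a(t)e₀`, `p = −a′(t)⟪e₀,x⟫` on the slab), `hasWeakSpatialGradientOn_neg`, `typeIBound_neg`,
  `isBackwardSingularPoint_neg`, `isBackwardSingularPoint_of_norm_le` (monotonicity of backward singularity).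

Written by the disprover of `ScarRigidity` (cycle 2); the crux-shaped corollaries live in
`Summits/…/Theorems/ScarRigidity/Negative/`.

## References

* G. Koch, N. Nadirashvili, G. Seregin, V. Šverák, *Liouville theorems for the Navier–Stokes equations and
  applications*, Acta Math. 203 (2009) 83–105, §1 (parasitic solutions `u = b(t)`, `p = −b′(t)·x`). [KNSS2009]
* Z. Lei, Z. Yang, C. Yuan, *Backward uniqueness for 3D Navier–Stokes equations with non-trivial final data
  and applications*, IMRN (2024) = arXiv:2311.02429, Example 1.2. [LeiYangYuan2024]
* D. Albritton, T. Barker, J. Math. Fluid Mech. 21 (2019), §1 (`𝐈`, singular points). [AlbrittonBarker2019]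
-/

noncomputable section

open Set Filter Function MeasureTheory Metric TopologicalSpace
open scoped Topology ENNReal NNReal InnerProductSpace RealInnerProductSpace Laplacian

namespace Literature.Analysis.FluidPDE

/-- Local notation for physical space `ℝ³ = EuclideanSpace ℝ (Fin 3)`. -/
local notation "ℝ³" => EuclideanSpace ℝ (Fin 3)

/-- Local notation for the open backward slab `(-∞, 0) × ℝ³` (time first). -/
local notation "𝕊" => slab (EuclideanSpace ℝ (Fin 3)) (Iio (0 : ℝ)) isOpen_Iio

/-! ## Sign-blindness of the apex-class notions; monotonicity of backward singularity -/

/-- `|−A|² = |A|²` for the Frobenius norm (local copy of `frobeniusNormSq_neg`, `TrilinearSkew`). [folklore] -/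
theorem frobeniusNormSq_neg' (A : ℝ³ →L[ℝ] ℝ³) : frobeniusNormSq (-A) = frobeniusNormSq A := by
  simp [frobeniusNormSq]

/-- NEGATION RULE for weak spatial gradients: `−G` is a weak gradient of `−u`. [folklore] -/
theorem hasWeakSpatialGradientOn_neg {Q : Opens (ℝ × ℝ³)} {u : ℝ → ℝ³ → ℝ³}
    {G : ℝ → ℝ³ → ℝ³ →L[ℝ] ℝ³} (h : HasWeakSpatialGradientOn Q u G) :
    HasWeakSpatialGradientOn Q (fun t x => -u t x) (fun t x => -G t x) where
  locallyIntegrableOn := by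
    have e : uncurry (fun t x => -u t x) = -uncurry u := rfl
    rw [e]; exact h.locallyIntegrableOn.neg
  locallyIntegrableOn_grad := by
    have e : uncurry (fun t x => -G t x) = -uncurry G := rfl
    rw [e]; exact h.locallyIntegrableOn_grad.neg
  integral_fderiv_mul_inner_eq φ hφ v w := by
    have e := h.integral_fderiv_mul_inner_eq φ hφ v w
    simp only [neg_apply, inner_neg_left, mul_neg, integral_neg, e, neg_neg]

/-- `𝐈` is blind to the sign of `(u, G)` (every scaled quantity is a norm). [folklore] -/
theorem typeIBound_neg (ω : Set (ℝ × ℝ³)) (u : ℝ → ℝ³ → ℝ³) (p : ℝ → ℝ³ → ℝ)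
    (G : ℝ → ℝ³ → ℝ³ →L[ℝ] ℝ³) :
    typeIBound ω (fun t x => -u t x) p (fun t x => -G t x) = typeIBound ω u p G := by
  simp only [typeIBound, abScaledSum, cknAEss, cknC, cknE, enorm_neg, frobeniusNormSq_neg']

/-- Sign-blindness of the apex bound. [folklore] -/
theorem hasTypeIDecay_neg {C : ℝ} {u : ℝ → ℝ³ → ℝ³} (h : HasTypeIDecay C u) :
    HasTypeIDecay C (fun t x => -u t x) := fun t ht x => by
  rw [norm_neg]; exact h t ht x

/-- Sign-blindness of backward singular points. [folklore] -/
theorem isBackwardSingularPoint_neg {u : ℝ → ℝ³ → ℝ³} {z : ℝ × ℝ³} (h : IsBackwardSingularPoint u z) :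
    IsBackwardSingularPoint (fun t x => -u t x) z := fun r hr => by
  have e : uncurry (fun t x => -u t x) = -uncurry u := rfl
  rw [e, eLpNorm_neg]; exact h r hr

/-- A compact set missing the origin keeps a positive distance `ρ` from it. [folklore] -/
theorem exists_pos_le_norm_of_isCompact {K : Set ℝ³} (hK : IsCompact K) (h0 : (0 : ℝ³) ∉ K) :
    ∃ ρ : ℝ, 0 < ρ ∧ ∀ x ∈ K, ρ ≤ ‖x‖ := by
  obtain ⟨ρ, hρ, hball⟩ := Metric.isOpen_iff.1 hK.isClosed.isOpen_compl 0 h0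
  refine ⟨ρ, hρ, fun x hx => ?_⟩
  by_contra hlt
  have hlt : ‖x‖ < ρ := not_le.1 hlt
  exact hball (by simpa using hlt) hx

/-- MONOTONICITY OF BACKWARD SINGULARITY: a pointwise larger field is singular where the smaller one
is. [folklore] -/
theorem isBackwardSingularPoint_of_norm_le {u v : ℝ → ℝ³ → ℝ³} {z : ℝ × ℝ³}
    (hu : IsBackwardSingularPoint u z) (h : ∀ t x, ‖u t x‖ ≤ ‖v t x‖) :
    IsBackwardSingularPoint v z := fun r hr => by
  have hle : eLpNorm (uncurry u) ∞ (volume.restrict (parabolicCylinder r z)) ≤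
      eLpNorm (uncurry v) ∞ (volume.restrict (parabolicCylinder r z)) :=
    eLpNorm_mono fun w => h w.1 w.2
  rw [hu r hr] at hle
  exact eq_top_iff.2 hle


/-! ## Drifts `a(t) e₀` (KNSS 2009 §1 parasitic solutions) -/

namespace ScarWitness

/-- The spatially uniform flow with scalar amplitude `a(t)` along `e₀`: `u(t,x) = a(t) e₀`. [folklore] -/
def ampDrift (a : ℝ → ℝ) : ℝ → ℝ³ → ℝ³ := fun t _ => a t • parasiticDir

/-- Its pressure `p(t,x) = ⟪−a′(t) e₀, x⟫` (`∂ₜu = −∇p`). [folklore] -/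
def ampDriftPressure (a : ℝ → ℝ) : ℝ → ℝ³ → ℝ := fun t x => ⟪(-deriv a t) • parasiticDir, x⟫

/-- The parasitic flow of the tree is the drift with amplitude `C/√(−t)`. [folklore] -/
theorem parasiticVelocity_eq (C : ℝ) : parasiticVelocity C = ampDrift (parasiticAmp C) := rfl

section Drift

variable {a : ℝ → ℝ}

/-- Joint smoothness of the drift on the open slab. [folklore] -/
theorem contDiffOn_ampDrift {n : WithTop ℕ∞} (ha : ContDiffOn ℝ n a (Iio 0)) :
    ContDiffOn ℝ n (uncurry (ampDrift a)) (Iio 0 ×ˢ univ) := by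
  have h : ContDiffOn ℝ n (fun z : ℝ × ℝ³ => a z.1) (Iio 0 ×ˢ univ) :=
    ha.comp contDiffOn_fst fun z hz => hz.1
  exact h.smul contDiffOn_const

/-- Joint `C¹` smoothness of the drift pressure on the open slab. [folklore] -/
theorem contDiffOn_ampDriftPressure (ha : ContDiffOn ℝ 2 a (Iio 0)) :
    ContDiffOn ℝ 1 (uncurry (ampDriftPressure a)) (Iio 0 ×ˢ univ) := by
  have ha' : ContDiffOn ℝ (1 + 1) a (Iio 0) := by rw [one_add_one_eq_two]; exact ha
  have h1 : ContDiffOn ℝ 1 (deriv a) (Iio 0) := ha'.deriv_of_isOpen isOpen_Iio le_rfl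
  have h2 : ContDiffOn ℝ 1 (fun z : ℝ × ℝ³ => (-deriv a z.1) • parasiticDir) (Iio 0 ×ˢ univ) :=
    ((h1.comp contDiffOn_fst fun z hz => hz.1).neg).smul contDiffOn_const
  exact h2.inner ℝ contDiffOn_snd

/-- `∂ₜu = a′(t) e₀` on `t < 0`. [folklore] -/
theorem timeDeriv_ampDrift (ha : ContDiffOn ℝ 2 a (Iio 0)) {t : ℝ} (ht : t < 0) (x : ℝ³) :
    timeDeriv (ampDrift a) t x = deriv a t • parasiticDir := by
  simp only [timeDeriv_apply, ampDrift]
  have hd : DifferentiableAt ℝ a t :=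
    (ha.differentiableOn (by norm_num)).differentiableAt (Iio_mem_nhds ht)
  exact (hd.hasDerivAt.smul_const parasiticDir).deriv

/-- The drift pair solves Navier–Stokes (`ν = 1`, `f = 0`) pointwise on `t < 0`. [folklore] -/
theorem momentum_ampDrift (ha : ContDiffOn ℝ 2 a (Iio 0)) {t : ℝ} (ht : t ∈ Iio (0 : ℝ)) (x : ℝ³) :
    timeDeriv (ampDrift a) t x + convect (ampDrift a t) (ampDrift a t) x =
      (1 : ℝ) • (Δ (ampDrift a t)) x - gradient (ampDriftPressure a t) x + (0 : ℝ → ℝ³ → ℝ³) t x := by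
  have h1 : convect (ampDrift a t) (ampDrift a t) x = 0 := by
    show fderiv ℝ (fun _ : ℝ³ => a t • parasiticDir) x (a t • parasiticDir) = 0
    simp
  have h2 : Δ (ampDrift a t) x = 0 := by
    show Δ (fun _ : ℝ³ => a t • parasiticDir) x = 0
    rw [InnerProductSpace.laplacian_const]
    rfl
  have h3 : gradient (ampDriftPressure a t) x = (-deriv a t) • parasiticDir := gradient_inner_left_eq _ x
  rw [timeDeriv_ampDrift ha ht x, h1, h2, h3]
  simp [neg_smul]

/-- `div u = 0`. [folklore] -/
theorem isDivFree_ampDrift (a : ℝ → ℝ) (t : ℝ) : VectorCalculus.IsDivFree (ampDrift a t) := by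
  intro x
  show VectorCalculus.divergence (fun _ : ℝ³ => a t • parasiticDir) x = 0
  simp [VectorCalculus.divergence]

/-- **Every smooth drift is a suitable weak solution of Navier–Stokes on the backward slab**
(classical `C²/C¹` solutions are suitable, CKN 1982 §2; KNSS 2009 §1 "parasitic solutions").
[cite: KNSS2009, §1] -/
theorem ampDrift_isSuitable (ha : ContDiffOn ℝ 2 a (Iio 0)) :
    IsSuitableWeakSolutionOn 𝕊 1 0 (ampDrift a) (ampDriftPressure a) :=
  isSuitableWeakSolutionOn_of_contDiffOn (S := Iio 0) isOpen_Iio (by simp)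
    (contDiffOn_ampDrift ha) (contDiffOn_ampDriftPressure ha) continuousOn_const
    (fun _ ht x => momentum_ampDrift ha ht x) (fun t _ => isDivFree_ampDrift a t)

/-- Its classical gradient is a weak spatial gradient on the slab. [folklore] -/
theorem ampDrift_hasWeakSpatialGradientOn (ha : ContDiffOn ℝ 1 a (Iio 0)) :
    HasWeakSpatialGradientOn 𝕊 (ampDrift a) (fun t x => fderiv ℝ (ampDrift a t) x) :=
  hasWeakSpatialGradientOn_of_contDiffOn (S := Iio 0) isOpen_Iio (by simp) (contDiffOn_ampDrift ha)

/-- `‖a(t) e₀‖ = |a(t)|`. [folklore] -/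
theorem norm_ampDrift (a : ℝ → ℝ) (t : ℝ) (x : ℝ³) : ‖ampDrift a t x‖ = |a t| := by
  show ‖a t • parasiticDir‖ = _
  rw [norm_smul, norm_parasiticDir, mul_one, Real.norm_eq_abs]

end Drift

/-- The bump `h(t) = (−t)/(1+t²)`: smooth, `0 < h(t) ≤ −t` for `t < 0`, `h(t)√(−t) ≤ 1`. [folklore] -/
def timeBump (t : ℝ) : ℝ := -t / (1 + t ^ 2)

/-- `h` is smooth. [folklore] -/
theorem contDiff_timeBump {n : WithTop ℕ∞} : ContDiff ℝ n timeBump :=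
  contDiff_id.neg.div (contDiff_const.add (contDiff_id.pow 2)) fun t => by positivity

/-- `0 < h(t)` for `t < 0`. [folklore] -/
theorem timeBump_pos {t : ℝ} (ht : t < 0) : 0 < timeBump t := div_pos (by linarith) (by positivity)

/-- `h(t) ≤ −t` for `t < 0`. [folklore] -/
theorem timeBump_le {t : ℝ} (ht : t < 0) : timeBump t ≤ -t := by
  unfold timeBump
  rw [div_le_iff₀ (by positivity)]
  nlinarith [sq_nonneg t]

/-- `h(t) ≤ 1/√(−t)` for `t < 0` (`s^{3/2} ≤ 1 + s²`). [folklore] -/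
theorem timeBump_le_inv_sqrt {t : ℝ} (ht : t < 0) : timeBump t ≤ 1 / Real.sqrt (-t) := by
  set s := -t with hs
  have hs0 : 0 < s := by linarith
  have e : timeBump t = s / (1 + s ^ 2) := by simp [timeBump, hs]
  rw [e, div_le_div_iff₀ (by positivity) (Real.sqrt_pos.2 hs0), one_mul]
  rcases le_or_gt s 1 with h1 | h1
  · have : Real.sqrt s ≤ 1 := by rw [← Real.sqrt_one]; exact Real.sqrt_le_sqrt h1
    nlinarith [Real.sqrt_nonneg s, sq_nonneg s]
  · have hss : Real.sqrt s ≤ s := by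
      have : Real.sqrt s ≤ Real.sqrt (s ^ 2) := Real.sqrt_le_sqrt (by nlinarith)
      rwa [Real.sqrt_sq hs0.le] at this
    nlinarith [Real.sqrt_nonneg s]

/-- The perturbed parasitic amplitude `b₂(t) = C/√(−t) + h(t)`. [folklore] -/
def pertAmp (C : ℝ) (t : ℝ) : ℝ := parasiticAmp C t + timeBump t

/-- `b₂` is smooth on `t < 0`. [folklore] -/
theorem contDiffOn_pertAmp (C : ℝ) {n : WithTop ℕ∞} : ContDiffOn ℝ n (pertAmp C) (Iio 0) :=
  (contDiffOn_parasiticAmp C).add contDiff_timeBump.contDiffOn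

/-- `b₂ ≥ 0` on `t < 0` for `C ≥ 0`. [folklore] -/
theorem pertAmp_nonneg {C : ℝ} (hC : 0 ≤ C) {t : ℝ} (ht : t < 0) : 0 ≤ pertAmp C t :=
  add_nonneg (parasiticAmp_nonneg hC t) (timeBump_pos ht).le

/-- The perturbed drift has the Type-I RATE with constant `C + 1`. [folklore] -/
theorem pertDrift_hasTypeITimeDecay {C : ℝ} (hC : 0 ≤ C) :
    HasTypeITimeDecay (C + 1) (ampDrift (pertAmp C)) := by
  intro t ht x
  rw [norm_ampDrift, abs_of_nonneg (pertAmp_nonneg hC ht), pertAmp, parasiticAmp, add_div]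
  exact add_le_add le_rfl (timeBump_le_inv_sqrt ht)

/-- The parasitic flow has the rate with the (larger) constant `C + 1` as well. [folklore] -/
theorem parasitic_hasTypeITimeDecay' {C : ℝ} (hC : 0 ≤ C) :
    HasTypeITimeDecay (C + 1) (parasiticVelocity C) := by
  intro t ht x
  refine (parasitic_hasTypeITimeDecay hC t ht x).trans ?_
  exact div_le_div_of_nonneg_right (by linarith) (Real.sqrt_nonneg _)

/-- The perturbed drift is backward-singular at the origin (it dominates the parasitic flow pointwise
on `t < 0`; both are `+∞`-free junk `0`-bounded for `t ≥ 0`, where `√(−t) = 0`). [folklore] -/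
theorem pertDrift_isBackwardSingularPoint {C : ℝ} (hC : 0 < C) :
    IsBackwardSingularPoint (ampDrift (pertAmp C)) 0 := by
  refine isBackwardSingularPoint_of_norm_le (parasitic_isBackwardSingularPoint_zero hC) fun t x => ?_
  rw [parasiticVelocity_eq, norm_ampDrift, norm_ampDrift]
  rcases lt_or_ge t 0 with ht | ht
  · rw [abs_of_nonneg (parasiticAmp_nonneg hC.le t), abs_of_nonneg (pertAmp_nonneg hC.le ht), pertAmp]
    linarith [timeBump_pos ht]
  · have h0 : parasiticAmp C t = 0 := by
      simp [parasiticAmp, Real.sqrt_eq_zero'.2 (by linarith : -t ≤ 0)]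
    simp [pertAmp, h0]

/-- The two drifts have the SAME SCAR: `‖b₁(t) − b₂(t)‖ = h(t) ≤ −t < δ` on `(−δ,0) × K`. [folklore] -/
theorem sameScar_parasitic_pert (C : ℝ) : ∀ K : Set ℝ³, IsCompact K → (0 : ℝ³) ∉ K →
    Tendsto (fun δ : ℝ => eLpNorm (uncurry (parasiticVelocity C) - uncurry (ampDrift (pertAmp C))) ⊤
      (volume.restrict (Ioo (-δ) 0 ×ˢ K))) (𝓝[>] 0) (𝓝 0) := by
  intro K hK _
  have hmeas : ∀ δ : ℝ, MeasurableSet (Ioo (-δ) (0 : ℝ) ×ˢ K) := fun δ =>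
    measurableSet_Ioo.prod hK.isClosed.measurableSet
  have hbound : ∀ δ : ℝ, 0 < δ → eLpNorm (uncurry (parasiticVelocity C) - uncurry (ampDrift (pertAmp C))) ⊤
      (volume.restrict (Ioo (-δ) 0 ×ˢ K)) ≤ ENNReal.ofReal δ := by
    intro δ hδ
    rw [eLpNorm_exponent_top]
    refine eLpNormEssSup_le_of_ae_bound ?_
    filter_upwards [ae_restrict_mem (hmeas δ)] with z hz
    obtain ⟨⟨hz1, hz2⟩, -⟩ := hz
    have e : (uncurry (parasiticVelocity C) - uncurry (ampDrift (pertAmp C))) z = (-timeBump z.1) • parasiticDir := by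
      simp only [Pi.sub_apply, uncurry, parasiticVelocity_eq, ampDrift, pertAmp, ← sub_smul]
      congr 1; ring
    rw [e, norm_smul, norm_parasiticDir, mul_one, norm_neg, Real.norm_of_nonneg (timeBump_pos hz2).le]
    linarith [timeBump_le hz2]
  have hup : Tendsto (fun δ : ℝ => ENNReal.ofReal δ) (𝓝[>] 0) (𝓝 0) := by
    simpa using (ENNReal.tendsto_ofReal (tendsto_id (x := 𝓝 (0 : ℝ)))).mono_left nhdsWithin_le_nhds
  refine tendsto_of_tendsto_of_tendsto_of_le_of_le' tendsto_const_nhds hup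
    (Eventually.of_forall fun δ => zero_le) ?_
  filter_upwards [self_mem_nhdsWithin] with δ hδ
  exact hbound δ hδ


/-- **A singular rate-Type-I Navier–Stokes pair with the same scar which is not a.e. equal** (KNSS 2009 §1;
Lei–Yang–Yuan 2024, Example 1.2 made singular and scale-critical): `u₁ = (1/√−t) e₀` (the parasitic flow),
`u₂ = (1/√−t + (−t)/(1+t²)) e₀`; both classical on the open slab, hence suitable weak with weak gradients;
both obey `‖u‖ ≤ 2/√(−t)`; both are backward-singular at the origin (indeed at every final-time point);
`‖u₁ − u₂‖ = (−t)/(1+t²) ≤ −t` gives the same scar; they differ at every point of the slab.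
[cite: KNSS2009, §1] -/
theorem exists_sameScar_rate_singular_not_aeEq_slab :
    ∃ (C : ℝ) (u₁ u₂ : ℝ → ℝ³ → ℝ³) (p₁ p₂ : ℝ → ℝ³ → ℝ) (G₁ G₂ : ℝ → ℝ³ → ℝ³ →L[ℝ] ℝ³),
      IsSuitableWeakSolutionOn 𝕊 1 0 u₁ p₁ ∧ HasWeakSpatialGradientOn 𝕊 u₁ G₁ ∧ HasTypeITimeDecay C u₁ ∧
      IsBackwardSingularPoint u₁ 0 ∧
      IsSuitableWeakSolutionOn 𝕊 1 0 u₂ p₂ ∧ HasWeakSpatialGradientOn 𝕊 u₂ G₂ ∧ HasTypeITimeDecay C u₂ ∧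
      IsBackwardSingularPoint u₂ 0 ∧
      (∀ K : Set ℝ³, IsCompact K → (0 : ℝ³) ∉ K →
        Tendsto (fun δ : ℝ => eLpNorm (uncurry u₁ - uncurry u₂) ⊤
          (volume.restrict (Ioo (-δ) 0 ×ˢ K))) (𝓝[>] 0) (𝓝 0)) ∧
      ¬ (uncurry u₁ =ᵐ[volume.restrict (Iio (0 : ℝ) ×ˢ (univ : Set ℝ³))] uncurry u₂) := by
  have hC : (0 : ℝ) < 1 := one_pos
  refine ⟨1 + 1, parasiticVelocity 1, ampDrift (pertAmp 1), parasiticPressure 1, ampDriftPressure (pertAmp 1),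
    _, _, parasitic_isSuitableWeakSolutionOn 1, parasitic_hasWeakSpatialGradientOn 1,
    parasitic_hasTypeITimeDecay' hC.le, parasitic_isBackwardSingularPoint_zero hC,
    ampDrift_isSuitable (contDiffOn_pertAmp 1), ampDrift_hasWeakSpatialGradientOn (contDiffOn_pertAmp 1 (n := 1)),
    pertDrift_hasTypeITimeDecay hC.le, pertDrift_isBackwardSingularPoint hC, sameScar_parasitic_pert 1, ?_⟩
  refine not_aeEq_restrict_of_forall_ne_of_isOpen (isOpen_Iio.prod isOpen_univ)
    ⟨((-1 : ℝ), (0 : ℝ³)), by simp⟩ subset_rfl (fun z hz => ?_)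
  have ht : z.1 < 0 := (mem_prod.1 hz).1
  have hdir : parasiticDir ≠ 0 := fun h0 => by
    have := norm_parasiticDir; rw [h0, norm_zero] at this; exact zero_ne_one this
  simp only [uncurry, parasiticVelocity_eq, ampDrift]
  intro heq
  have := smul_left_injective ℝ hdir heq
  simp only [pertAmp] at this
  linarith [timeBump_pos ht]

end ScarWitness

/-! ## The kinematic pair `u`, `−u` -/

open ParabolicBump in
/-- The kinematic bump has ZERO SCAR against any multiple of itself: for compact `K ∌ 0` and
`δ ≤ ρ²/4` it vanishes identically on `(−δ,0) × K` (support `‖x‖ < 2√(−t)`). [folklore] -/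
theorem sameScar_apex_neg : ∀ K : Set ℝ³, IsCompact K → (0 : ℝ³) ∉ K →
    Tendsto (fun δ : ℝ => eLpNorm (uncurry apexVelocity - uncurry fun t x => -apexVelocity t x) ⊤
      (volume.restrict (Ioo (-δ) 0 ×ˢ K))) (𝓝[>] 0) (𝓝 0) := by
  intro K hK h0
  obtain ⟨ρ, hρ, hKρ⟩ := exists_pos_le_norm_of_isCompact hK h0
  have hev : ∀ᶠ δ in 𝓝[>] (0 : ℝ), eLpNorm (uncurry apexVelocity - uncurry fun t x => -apexVelocity t x) ⊤
      (volume.restrict (Ioo (-δ) 0 ×ˢ K)) = 0 := by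
    have hmem : Ioo (0 : ℝ) (ρ ^ 2 / 4) ∈ 𝓝[>] (0 : ℝ) := Ioo_mem_nhdsGT (by positivity)
    filter_upwards [hmem] with δ hδ
    have hae : (uncurry apexVelocity - uncurry fun t x => -apexVelocity t x)
        =ᵐ[volume.restrict (Ioo (-δ) 0 ×ˢ K)] 0 := by
      filter_upwards [ae_restrict_mem (measurableSet_Ioo.prod hK.isClosed.measurableSet)] with z hz
      obtain ⟨⟨hz1, hz2⟩, hzK⟩ := hz
      have ht : z.1 < 0 := hz2
      have hsqrt : 2 * Real.sqrt (-z.1) ≤ ‖z.2‖ := by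
        refine le_trans ?_ (hKρ z.2 hzK)
        have h1 : -z.1 < ρ ^ 2 / 4 := by linarith [hδ.2]
        have h2 : Real.sqrt (-z.1) < ρ / 2 := by
          calc Real.sqrt (-z.1) < Real.sqrt (ρ ^ 2 / 4) := Real.sqrt_lt_sqrt (by linarith) h1
            _ = ρ / 2 := by
              rw [show ρ ^ 2 / 4 = (ρ / 2) ^ 2 by ring, Real.sqrt_sq (by linarith)]
        linarith
      have hzero := apexVelocity_eq_zero_of ht hsqrt
      simp [uncurry, hzero]
    rw [eLpNorm_congr_ae hae, eLpNorm_zero]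
  exact (tendsto_congr' hev).2 tendsto_const_nhds


open ParabolicBump in
/-- **A singular apex-class pair WITHOUT the equations, with the same scar, not a.e. equal**: the kinematic
bump `u = χ(|x|²/(−t))/√(−t) e₀` of `KinematicApexWitness` and `−u` (weak gradients `±∇u`, `𝐈 < ∞` with
pressure `0`, apex bound with `C = 3`, both backward-singular at the origin, zero scar each) differ on the
open set `{‖x‖² < −t}`.  [folklore] -/
theorem exists_sameScar_apex_singular_kinematic_not_aeEq_slab :
    ∃ (C : ℝ) (u₁ u₂ : ℝ → ℝ³ → ℝ³) (G₁ G₂ : ℝ → ℝ³ → ℝ³ →L[ℝ] ℝ³),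
      HasWeakSpatialGradientOn 𝕊 u₁ G₁ ∧ typeIBound (Iio (0 : ℝ) ×ˢ univ) u₁ 0 G₁ < ⊤ ∧ HasTypeIDecay C u₁ ∧
      IsBackwardSingularPoint u₁ 0 ∧
      HasWeakSpatialGradientOn 𝕊 u₂ G₂ ∧ typeIBound (Iio (0 : ℝ) ×ˢ univ) u₂ 0 G₂ < ⊤ ∧ HasTypeIDecay C u₂ ∧
      IsBackwardSingularPoint u₂ 0 ∧
      (∀ K : Set ℝ³, IsCompact K → (0 : ℝ³) ∉ K →
        Tendsto (fun δ : ℝ => eLpNorm (uncurry u₁ - uncurry u₂) ⊤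
          (volume.restrict (Ioo (-δ) 0 ×ˢ K))) (𝓝[>] 0) (𝓝 0)) ∧
      ¬ (uncurry u₁ =ᵐ[volume.restrict (Iio (0 : ℝ) ×ˢ (univ : Set ℝ³))] uncurry u₂) := by
  have hG := apex_hasWeakSpatialGradientOn
  have hI := typeIBound_apex_lt_top
  have hI' : typeIBound (Iio (0 : ℝ) ×ˢ univ) (fun t x => -apexVelocity t x) 0
      (fun t x => -apexGradient t x) < ⊤ := by
    rw [typeIBound_neg]; exact hI
  refine ⟨3, apexVelocity, fun t x => -apexVelocity t x, apexGradient, fun t x => -apexGradient t x,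
    hG, hI, apex_hasTypeIDecay, apex_isBackwardSingularPoint,
    hasWeakSpatialGradientOn_neg hG, hI', hasTypeIDecay_neg apex_hasTypeIDecay,
    isBackwardSingularPoint_neg apex_isBackwardSingularPoint, sameScar_apex_neg, ?_⟩
  -- the two fields differ on the open set `{t < 0, ‖x‖² < −t}`
  set U : Set (ℝ × ℝ³) := {z | z.1 < 0 ∧ ‖z.2‖ ^ 2 < -z.1} with hUdef
  have hU : IsOpen U :=
    (isOpen_lt continuous_fst continuous_const).inter
      (isOpen_lt (continuous_snd.norm.pow 2) continuous_fst.neg)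
  have hUne : U.Nonempty := ⟨((-1 : ℝ), (0 : ℝ³)), by simp [hUdef]⟩
  have hUS : U ⊆ Iio (0 : ℝ) ×ˢ (univ : Set ℝ³) := fun z hz => ⟨hz.1, mem_univ _⟩
  refine not_aeEq_restrict_of_forall_ne_of_isOpen hU hUne hUS (fun z hz => ?_)
  obtain ⟨ht, hx⟩ := hz
  simp only [uncurry]
  intro heq
  have hamp : apexAmp z.1 z.2 = 1 / Real.sqrt (-z.1) := apexAmp_eq_of ht hx.le
  have hpos : 0 < apexAmp z.1 z.2 := by rw [hamp]; exact div_pos one_pos (Real.sqrt_pos.2 (by linarith))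
  have hsum : (apexAmp z.1 z.2 + apexAmp z.1 z.2) • parasiticDir = 0 := by
    rw [add_smul]
    exact eq_neg_iff_add_eq_zero.1 heq
  rcases smul_eq_zero.1 hsum with hzero | hdir
  · linarith
  · have := norm_parasiticDir
    rw [hdir, norm_zero] at this
    exact zero_ne_one this

end Literature.Analysis.FluidPDE

end
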